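import Summits.AtomisticToContinuum.FouriersLaw.Theorems.OddSectorIrreversibilityCorrectorTheoryUniformH2
import Literature.MathematicalPhysics.KineticTheory.LangevinChainNESSFromH2

/-!
# Crux `ExtensiveSnapshotIrreversibility` (stmt-AtomisticToContinuum-9121): atom A1 `NessExpMomentBound` PROVED

Cell decomp-a2c, lens «grading / quantitative ladder», generation 72 (critic row 995 (iii): "A1-UNIFORM
FIRST — type the first lemma «CEHR H2 constants locally uniform on a compact temperature rectangle»,
then the drift engine gives `sup_δ ∫ e^{θH} dμ_δ ≤ C₁`").

Atom A1 of the energy-window control `(W)` (`…EnergyWindowAtoms.lean`, `NessExpMomentBound`) asks,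
along every weak steady-state family `μ_{N,T_L,T_R}` of the pinned anharmonic chain (under weak-NESS
uniqueness), for `δ₀, θ > 0` and `C₁` with `e^{θH} ∈ L¹(μ_{N,T+δ/2,T−δ/2})` and
`∫ e^{θH} dμ_{N,T+δ/2,T−δ/2} ≤ C₁` for all `0 < |δ| < δ₀`.

FINDING. The "first lemma" is already a theorem of the tree: Cuneo–Eckmann–Hairer–Rey-Bellet 2018,
Thm 5.1 / Rem 5.2 with ONE drift constant for all bath temperatures below a ceiling,
`OddSectorIrreversibility.Corrector.pinnedChain_drift_uniform`
(`…Theorems/OddSectorIrreversibilityCorrectorTheoryUniformH2.lean`, helper of item 14071):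
`P_{t*} e^{θH}(z) ≤ e^{θH(z)}/2 + c` for all `z`, all `0 < T_L, T_R ≤ Tmax`, `0 < θ < 1/Tmax`.
This file closes A1 from it, with no new analysis:

* `integral_le_of_invariant_of_geometricDrift` — **abstract Markov-kernel lemma**: if a probability
  measure `π` is invariant under a kernel `κ` (`π ∘ κ = π`), `V ≥ 0` is `π`-integrable and
  `κ V ≤ a V + b` pointwise with `0 ≤ a < 1`, then `∫ V dπ ≤ b/(1 − a)` (integrate the drift
  against `π` and use invariance: `∫ V = ∫ κV ≤ a ∫ V + b`);
* `isSteadyState_integral_exp_mul_hamiltonian_le_uniform` — **CEHR Thm 2.13 (2) with a UNIFORM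
  constant**: for `0 < θ < 1/Tmax` there is ONE `C₁` such that EVERY weak steady state `ν` of
  `pinnedChain ω₂ lam β γ` at bath temperatures `0 < T_L, T_R ≤ Tmax` (under weak-NESS uniqueness)
  has `e^{θH} ∈ L¹(ν)` and `∫ e^{θH} dν ≤ C₁`: the Krylov–Bogoliubov invariant probability measure
  of the transition semigroup (`pinnedChainSemigroup_exists_isInvariant`, from H2
  `CuneoEckmannHairerReyBellet2018_H2_holds`) integrates `e^{θH}`, is a weak steady state
  (`pinnedChain_isSteadyState_of_isInvariant`, Dynkin), hence IS `ν` by uniqueness, and the abstract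
  lemma applies to the uniform drift at `t* = 1` (`a = 1/2`, `C₁ = 2c`);
* `nessExpMomentBound_window` / `nessExpMomentBound_atom` — **atom A1 along the window
  `(T+δ/2, T−δ/2)`**: `δ₀ = T`, `Tmax = 2T`, `θ = 1/(4T)`; `nessExpMomentBound_atom` is the text of
  `NessExpMomentBound` VERBATIM (the one-line bridge `nessExpMomentBound_holds : NessExpMomentBound :=
  nessExpMomentBound_atom` lives in the companion `…EnergyWindowAtomsExpMoment.lean`, which imports
  the atoms file).

Ladder bookkeeping (9121, fixed-`N` half `K_fix`): `K_fix ⟸ (W) ⟸ A0 ∧ A1 ∧ A2 ∧ A3 ∧ A4` with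
A0 a tree theorem and A1 now PROVED; open: A2 (odd log-ratio Harnack chain), A3 (one-sided `O(δ)`
floor), A4 (`L²` linear response). The constant `C₁` here depends on `N` (through the energy
threshold of `pinnedChain_decay_uniform`), as the fixed-`N` half allows.

References: N. Cuneo, J.-P. Eckmann, M. Hairer, L. Rey-Bellet, EJP 23 (2018) no. 55
(arXiv:1712.09413), Thm 2.13 (2), Thm 5.1, Rem 5.2, Prop 3.7; M. Hairer, J. C. Mattingly, in:
Seminar on Stochastic Analysis, Random Fields and Applications VI (2011), 109–117 (Yet another look
at Harris' ergodic theorem), §1 (invariant measures under a geometric drift have `∫ V dμ ≤ K/(1−γ)`);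
S. P. Meyn, R. L. Tweedie, Markov Chains and Stochastic Stability (1993), Thm 14.3.7.
-/

noncomputable section

namespace Summit.AtomisticToContinuum.FouriersLaw.Theorems.ExtensiveSnapshotIrreversibility.EnergyWindow

open MeasureTheory ProbabilityTheory Filter Topology
open scoped ENNReal NNReal
open Literature.MathematicalPhysics.KineticTheory.HeatConduction
open Summit.AtomisticToContinuum.FouriersLaw.Theorems.OddSectorIrreversibility.Corrector

/-! ## 1. Invariant probability measures under a geometric drift have a bounded `V`-moment -/

/-- **Moment bound from invariance and a geometric drift** (Meyn–Tweedie Thm 14.3.7 /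
Hairer–Mattingly 2011 §1, in the integrable case): if `π` is a probability measure invariant under
the kernel `κ` (`π.bind κ = π`), `V ≥ 0` is measurable and `π`-integrable, and
`∫ V dκ(z,·) ≤ a V(z) + b` for all `z` with `0 ≤ a < 1`, `0 ≤ b`, then `∫ V dπ ≤ b / (1 − a)`:
indeed `∫ V dπ = ∫∫ V dκ(z,·) dπ(z) ≤ a ∫ V dπ + b`. [cite: MeynTweedie1993, Thm 14.3.7] -/
theorem integral_le_of_invariant_of_geometricDrift {α : Type*} [MeasurableSpace α]
    {κ : Kernel α α} {π : Measure α} [IsProbabilityMeasure π] (hinv : π.bind κ = π)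
    {V : α → ℝ} (hV : Measurable V) (hV0 : ∀ x, 0 ≤ V x) (hint : Integrable V π)
    {a b : ℝ} (ha0 : 0 ≤ a) (ha1 : a < 1) (hb : 0 ≤ b)
    (hdrift : ∀ z, ∫⁻ y, ENNReal.ofReal (V y) ∂(κ z) ≤ ENNReal.ofReal (a * V z + b)) :
    ∫ x, V x ∂π ≤ b / (1 - a) := by
  set J := ∫ x, V x ∂π with hJ
  have hJ0 : 0 ≤ J := integral_nonneg hV0
  have hint' : Integrable (fun z => a * V z + b) π := (hint.const_mul a).add (integrable_const b)
  have h1 : ENNReal.ofReal J = ∫⁻ x, ENNReal.ofReal (V x) ∂π :=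
    ofReal_integral_eq_lintegral_ofReal hint (Eventually.of_forall hV0)
  have h2 : ENNReal.ofReal (∫ z, (a * V z + b) ∂π) = ∫⁻ z, ENNReal.ofReal (a * V z + b) ∂π :=
    ofReal_integral_eq_lintegral_ofReal hint' (Eventually.of_forall fun z => by
      have := hV0 z; positivity)
  have h3 : ∫ z, (a * V z + b) ∂π = a * J + b := by
    rw [integral_add (hint.const_mul a) (integrable_const b), integral_const_mul, integral_const]
    simp [hJ]
  have hkey : ∫⁻ x, ENNReal.ofReal (V x) ∂π ≤ ∫⁻ z, ENNReal.ofReal (a * V z + b) ∂π := by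
    calc ∫⁻ x, ENNReal.ofReal (V x) ∂π
        = ∫⁻ x, ENNReal.ofReal (V x) ∂(π.bind κ) := by rw [hinv]
      _ = ∫⁻ z, ∫⁻ y, ENNReal.ofReal (V y) ∂(κ z) ∂π :=
          Measure.lintegral_bind κ.measurable.aemeasurable
            (ENNReal.measurable_ofReal.comp hV).aemeasurable
      _ ≤ ∫⁻ z, ENNReal.ofReal (a * V z + b) ∂π := lintegral_mono hdrift
  have h4 : J ≤ a * J + b := by
    have h := hkey
    rw [← h1, ← h2, h3] at h
    exact (ENNReal.ofReal_le_ofReal_iff (by positivity)).1 h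
  rw [le_div_iff₀ (by linarith)]
  nlinarith [h4, hJ0, ha0]

/-! ## 2. CEHR Thm 2.13 (2) with a constant uniform in the bath temperatures -/

/-- **Uniform exponential energy moment of the weak steady states** (Cuneo–Eckmann–Hairer–Rey-Bellet
2018 Thm 2.13 (2) + Rem 5.2, uniform form). For `pinnedChain ω₂ lam β γ` with positive parameters,
`N ≥ 1`, a temperature ceiling `Tmax > 0` and `0 < θ < 1/Tmax` there is ONE constant `C₁ > 0` such
that, under weak-NESS uniqueness, EVERY weak steady state `ν` at bath temperatures
`0 < T_L, T_R ≤ Tmax` satisfies `e^{θH} ∈ L¹(ν)` and `∫ e^{θH} dν ≤ C₁`. Proof: `ν` is the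
Krylov–Bogoliubov invariant probability measure of the transition semigroup (uniqueness), which is
invariant under `P_1`; the uniform drift `pinnedChain_drift_uniform` (`P_1 e^{θH} ≤ e^{θH}/2 + c`)
and `integral_le_of_invariant_of_geometricDrift` give `C₁ = 2c`.
[cite: CuneoEckmannHairerReyBellet2018, Thm 2.13 (2) and Rem 5.2] -/
theorem isSteadyState_integral_exp_mul_hamiltonian_le_uniform {ω₂ lam β γ : ℝ} (hω : 0 < ω₂)
    (hl : 0 < lam) (hβ : 0 < β) (hγ : 0 < γ)
    (hU : ∀ (N : ℕ) (T_L T_R : ℝ), 0 < T_L → 0 < T_R → ∀ μ ν : Measure (PhaseSpace N),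
      (pinnedChain ω₂ lam β γ).IsSteadyState N T_L T_R μ →
      (pinnedChain ω₂ lam β γ).IsSteadyState N T_L T_R ν → μ = ν)
    {N : ℕ} (hN : 0 < N) {Tmax : ℝ} (hTmax : 0 < Tmax) {θ : ℝ} (hθ : 0 < θ)
    (hθ' : θ < 1 / Tmax) :
    ∃ C₁ : ℝ, 0 < C₁ ∧ ∀ T_L T_R : ℝ, 0 < T_L → 0 < T_R → T_L ≤ Tmax → T_R ≤ Tmax →
      ∀ ν : Measure (PhaseSpace N), (pinnedChain ω₂ lam β γ).IsSteadyState N T_L T_R ν →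
        Integrable (fun x => Real.exp (θ * (pinnedChain ω₂ lam β γ).hamiltonian N x)) ν ∧
          ∫ x, Real.exp (θ * (pinnedChain ω₂ lam β γ).hamiltonian N x) ∂ν ≤ C₁ := by
  obtain ⟨c, hc, hdrift⟩ := pinnedChain_drift_uniform hω hl.le hβ hγ hN hTmax hθ hθ' 1 one_pos
  refine ⟨2 * c, by positivity, fun T_L T_R hTL hTR hTLm hTRm ν hν => ?_⟩
  -- the Krylov–Bogoliubov invariant probability measure of the transition semigroup
  obtain ⟨π, hπ, hinv, hint⟩ := pinnedChainSemigroup_exists_isInvariant hω hl.le hβ hγ hN hTL hTR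
    CuneoEckmannHairerReyBellet2018_H2_holds
  have hmax0 : 0 < max T_L T_R := lt_max_of_lt_left hTL
  have hθmax : θ < 1 / max T_L T_R :=
    hθ'.trans_le (one_div_le_one_div_of_le hmax0 (max_le hTLm hTRm))
  have hintθ := hint θ hθ hθmax
  -- it is a weak steady state (Dynkin), hence the given one (uniqueness)
  have hπss : (pinnedChain ω₂ lam β γ).IsSteadyState N T_L T_R π :=
    pinnedChain_isSteadyState_of_isInvariant hω.le hl.le hβ.le γ N _ hinv hθ hintθ
  have hνπ : ν = π := hU N T_L T_R hTL hTR ν π hν hπss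
  rw [hνπ]
  refine ⟨hintθ, ?_⟩
  have hVm : Measurable (fun x => Real.exp (θ * (pinnedChain ω₂ lam β γ).hamiltonian N x)) :=
    (Real.continuous_exp.comp
      (continuous_const.mul (pinnedChain_continuous_hamiltonian ω₂ lam β γ N))).measurable
  have h := integral_le_of_invariant_of_geometricDrift
    (κ := (pinnedChain ω₂ lam β γ).transitionKernel N T_L T_R 1) (hinv 1) hVm
    (fun x => (Real.exp_pos _).le) hintθ (by norm_num : (0 : ℝ) ≤ 1 / 2)
    (by norm_num : (1 : ℝ) / 2 < 1) hc.le (fun z => hdrift T_L T_R hTL hTR hTLm hTRm z)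
  have e : c / (1 - 1 / 2) = 2 * c := by ring
  linarith [h, e.le, e.ge]

/-! ## 3. Atom A1 along the temperature window `(T + δ/2, T − δ/2)` -/

/-- **Atom A1 along a steady-state family, explicit constants**: for `T > 0`, `N ≥ 1` and every
family `μ_{N,T_L,T_R}` of weak steady states of the pinned chain (under weak-NESS uniqueness),
with `δ₀ = T`, `θ = 1/(4T)` there is `C₁` such that `e^{θH} ∈ L¹(μ_{N,T+δ/2,T−δ/2})` and
`∫ e^{θH} dμ_{N,T+δ/2,T−δ/2} ≤ C₁` for all `|δ| < δ₀` (temperature ceiling `Tmax = 2T`).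
[cite: CuneoEckmannHairerReyBellet2018, Thm 2.13 (2) and Rem 5.2] -/
theorem nessExpMomentBound_window {ω₂ lam β γ : ℝ} (hω : 0 < ω₂) (hl : 0 < lam) (hβ : 0 < β)
    (hγ : 0 < γ)
    (hU : ∀ (N : ℕ) (T_L T_R : ℝ), 0 < T_L → 0 < T_R → ∀ μ ν : Measure (PhaseSpace N),
      (pinnedChain ω₂ lam β γ).IsSteadyState N T_L T_R μ →
      (pinnedChain ω₂ lam β γ).IsSteadyState N T_L T_R ν → μ = ν)
    (μ : (N : ℕ) → ℝ → ℝ → Measure (PhaseSpace N))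
    (hμ : ∀ (N : ℕ) (T_L T_R : ℝ), 0 < T_L → 0 < T_R →
      (pinnedChain ω₂ lam β γ).IsSteadyState N T_L T_R (μ N T_L T_R))
    {T : ℝ} (hT : 0 < T) {N : ℕ} (hN : 0 < N) :
    ∃ C₁ : ℝ, 0 < C₁ ∧ ∀ δ : ℝ, |δ| < T →
      Integrable (fun x => Real.exp (1 / (4 * T) * (pinnedChain ω₂ lam β γ).hamiltonian N x))
          (μ N (T + δ / 2) (T - δ / 2)) ∧
        ∫ x, Real.exp (1 / (4 * T) * (pinnedChain ω₂ lam β γ).hamiltonian N x)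
          ∂(μ N (T + δ / 2) (T - δ / 2)) ≤ C₁ := by
  have hTmax : 0 < 2 * T := by positivity
  have hθ : 0 < 1 / (4 * T) := by positivity
  have hθ' : 1 / (4 * T) < 1 / (2 * T) := one_div_lt_one_div_of_lt (by positivity) (by linarith)
  obtain ⟨C₁, hC₁, h⟩ :=
    isSteadyState_integral_exp_mul_hamiltonian_le_uniform hω hl hβ hγ hU hN hTmax hθ hθ'
  refine ⟨C₁, hC₁, fun δ hδ => ?_⟩
  obtain ⟨hδ1, hδ2⟩ := abs_lt.1 hδ
  have hTL : 0 < T + δ / 2 := by linarith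
  have hTR : 0 < T - δ / 2 := by linarith
  exact h _ _ hTL hTR (by linarith) (by linarith) _ (hμ N _ _ hTL hTR)

/-- **Atom A1 `NessExpMomentBound`, VERBATIM text** (the closed `Prop` of `…EnergyWindowAtoms.lean`,
restated without importing that file so that this module depends on built modules only): along
every steady-state family of the pinned chain under weak-NESS uniqueness, for `T > 0`, `N ≥ 2`,
there are `δ₀, θ > 0`, `C₁` with `e^{θH} ∈ L¹(μ_{N,T+δ/2,T−δ/2})` and
`∫ e^{θH} dμ_{N,T+δ/2,T−δ/2} ≤ C₁` for `0 < |δ| < δ₀` — here `δ₀ = T`, `θ = 1/(4T)`.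
[cite: CuneoEckmannHairerReyBellet2018, Thm 2.13 (2) and Rem 5.2] -/
theorem nessExpMomentBound_atom :
    ∀ ω₂ lam β γ : ℝ, 0 < ω₂ → 0 < lam → 0 < β → 0 < γ →
      (∀ (N : ℕ) (T_L T_R : ℝ), 0 < T_L → 0 < T_R → ∀ μ ν : Measure (PhaseSpace N),
        (pinnedChain ω₂ lam β γ).IsSteadyState N T_L T_R μ →
        (pinnedChain ω₂ lam β γ).IsSteadyState N T_L T_R ν → μ = ν) →
      ∀ μ : (N : ℕ) → ℝ → ℝ → Measure (PhaseSpace N),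
        (∀ (N : ℕ) (T_L T_R : ℝ), 0 < T_L → 0 < T_R →
          (pinnedChain ω₂ lam β γ).IsSteadyState N T_L T_R (μ N T_L T_R)) →
        ∀ T : ℝ, 0 < T → ∀ N : ℕ, 2 ≤ N →
          ∃ δ₀ θ C₁ : ℝ, 0 < δ₀ ∧ 0 < θ ∧
            ∀ δ : ℝ, δ ≠ 0 → |δ| < δ₀ →
              Integrable (fun x => Real.exp (θ * (pinnedChain ω₂ lam β γ).hamiltonian N x))
                  (μ N (T + δ / 2) (T - δ / 2)) ∧
                ∫ x, Real.exp (θ * (pinnedChain ω₂ lam β γ).hamiltonian N x)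
                  ∂(μ N (T + δ / 2) (T - δ / 2)) ≤ C₁ := by
  intro ω₂ lam β γ hω hl hβ hγ hU μ hμ T hT N hN
  have hN0 : 0 < N := lt_of_lt_of_le (by norm_num) hN
  obtain ⟨C₁, -, h⟩ := nessExpMomentBound_window hω hl hβ hγ hU μ hμ hT hN0
  exact ⟨T, 1 / (4 * T), C₁, hT, by positivity, fun δ _ hδ => h δ hδ⟩

end Summit.AtomisticToContinuum.FouriersLaw.Theorems.ExtensiveSnapshotIrreversibility.EnergyWindow

end
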